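import Literature.Computability.Complexity.RandomizingPolynomialsPerfect
import HarnessLib

/-!
# Candidate proof of `stub_blockPerf` (line `dual-mode-compile`, crux stmt-PneNP-10777) — refuter by-product

Over copies of the skeleton's `entryOf` / `blockOf` (namespace `…Cruxes.PeaWorstToAvg.Drefute`) and the general
canonical form `exists_eq_canon_conj` (proved in `RandomizingPolynomialsHessenberg.lean`, repeated here so that this
file checks against the current tree), the block of a SYMBOLIC unit-lower-Hessenberg matrix is a perfect extension of
its determinant: `perfExt_blockOf`.  Proof = the tree's `perfExt_ikBlock` with `pathMat_eq` replaced by the general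
canonical form. [IshaiKushilevitz2002, §3; ApplebaumIshaiKushilevitz2006, §4.2]
-/

set_option linter.dupNamespace false

namespace Summit.PneNP.PneNP.Cruxes.PeaWorstToAvg.Drefute

open Literature.Computability.Complexity RandPoly Matrix Finset

/-! ## §0 Copies: skeleton definitions and the general canonical form -/

/-- (copy of the skeleton's `entryOf`) Entry `(i, k)` of the symbolic product `R₁ · L · R₂`. -/
def entryOf (n₀ d : ℕ) (Lsym : ℕ → ℕ → List (List ℕ)) (i k : ℕ) : List (List ℕ) :=
  (List.range (d + 1)).flatMap fun j => (List.range (d + 1)).flatMap fun l =>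
    RandPoly.mulP (RandPoly.mulP (RandPoly.symR1 n₀ i j) (Lsym j l)) (RandPoly.symR2 n₀ d l k)

/-- (copy of the skeleton's `blockOf`) The degree-3 block of a symbolic Hessenberg matrix. -/
def blockOf (n₀ d : ℕ) (Lsym : ℕ → ℕ → List (List ℕ)) : List (List (List ℕ)) :=
  (RandPoly.pairsLE d).map fun ik => entryOf n₀ d Lsym ik.1 ik.2

variable {d : ℕ}

theorem IsUnitri.det_eq_one' {A : Mat d} (hA : IsUnitri A) : A.det = 1 := by
  rw [Matrix.det_of_upperTriangular (fun i j hij => hA.2 i j hij)]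
  exact Finset.prod_eq_one fun i _ => hA.1 i

theorem IsUnitri.inv' {A : Mat d} (hA : IsUnitri A) : IsUnitri A⁻¹ := by
  have hdet : IsUnit A.det := by rw [IsUnitri.det_eq_one' hA]; exact isUnit_one
  haveI : Invertible A := Matrix.invertibleOfIsUnitDet A hdet
  have hbt : A.BlockTriangular id := fun i j hij => hA.2 i j hij
  have hinv : A⁻¹.BlockTriangular id := Matrix.blockTriangular_inv_of_blockTriangular hbt
  refine ⟨fun i => ?_, fun i j hij => hinv hij⟩
  have h := congrFun (congrFun (Matrix.nonsing_inv_mul A hdet) i) i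
  rw [Matrix.mul_apply, Matrix.one_apply_eq, Finset.sum_eq_single i] at h
  · rwa [hA.1 i, mul_one] at h
  · intro k _ hk
    rcases lt_or_gt_of_ne hk with hlt | hlt
    · rw [hinv hlt, zero_mul]
    · rw [hA.2 k i hlt, mul_zero]
  · simp

theorem det_canon' (δ : ZMod 2) : (canon δ : Mat d).det = δ := by
  rw [Matrix.det_succ_row_zero, Finset.sum_eq_single (Fin.last d)]
  · have hminor : (canon δ : Mat d).submatrix Fin.succ (Fin.last d).succAbove = 1 := by
      ext i k
      rw [Matrix.submatrix_apply, Fin.succAbove_last, canon_apply, Matrix.one_apply]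
      have h1 : ¬ (Fin.succ i = 0 ∧ Fin.castSucc k = Fin.last d) := fun h => Fin.succ_ne_zero i h.1
      rw [if_neg h1, add_zero]
      by_cases hik : i = k
      · subst hik; simp
      · rw [if_neg hik, if_neg]
        intro h; apply hik; exact Fin.ext (by simpa using h)
    rw [hminor, Matrix.det_one, mul_one, canon_apply]
    have hz : ¬ ((0 : Fin (d + 1)).val = (Fin.last d).val + 1) := by simp
    rw [if_neg hz, zero_add, if_pos ⟨rfl, rfl⟩]
    have hneg : ((-1 : ZMod 2) ^ (Fin.last d : ℕ)) = 1 := by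
      have : (-1 : ZMod 2) = 1 := by decide
      rw [this, one_pow]
    rw [hneg, one_mul]
  · intro j _ hj
    rw [canon_apply]
    have hz : ¬ ((0 : Fin (d + 1)).val = j.val + 1) := by simp
    have hc : ¬ ((0 : Fin (d + 1)) = 0 ∧ j = Fin.last d) := fun h => hj h.2
    rw [if_neg hz, if_neg hc, add_zero, mul_zero, zero_mul]
  · simp

theorem exists_canon_of_hessenberg' (L : Mat d)
    (hsub : ∀ i j : Fin (d + 1), i.val = j.val + 1 → L i j = 1)
    (hlow : ∀ i j : Fin (d + 1), j.val + 1 < i.val → L i j = 0) :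
    ∃ A B : Mat d, IsUnitri A ∧ IsLastCol B ∧ A * L * B = canon L.det := by
  -- `U = [e₀ | columns 0 … d-1 of L]`, upper unitriangular
  obtain ⟨U, hUdef⟩ : ∃ U : Mat d, U = Matrix.of fun j k : Fin (d + 1) =>
      if hk : k.val = 0 then (if j.val = 0 then (1 : ZMod 2) else 0) else L j ⟨k.val - 1, by omega⟩ := ⟨_, rfl⟩
  have hUsucc : ∀ (j k : Fin (d + 1)) (hk : k.val + 1 < d + 1), U j ⟨k.val + 1, hk⟩ = L j k := by
    intro j k hk
    rw [hUdef, Matrix.of_apply, dif_neg (by simp)]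
    congr 1
  have hUtri : IsUnitri U := by
    refine ⟨fun i => ?_, fun i j hji => ?_⟩
    · rw [hUdef, Matrix.of_apply]
      by_cases hi : i.val = 0
      · rw [dif_pos hi, if_pos hi]
      · rw [dif_neg hi]
        exact hsub _ _ (by simp; omega)
    · rw [hUdef, Matrix.of_apply]
      have hji' : j.val < i.val := hji
      by_cases hj : j.val = 0
      · rw [dif_pos hj, if_neg (by omega)]
      · rw [dif_neg hj]
        exact hlow _ _ (by simp; omega)
  -- the row eliminator `A = U⁻¹`
  have hUdet : IsUnit U.det := by rw [IsUnitri.det_eq_one' hUtri]; exact isUnit_one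
  obtain ⟨A, hAdef⟩ : ∃ A : Mat d, A = U⁻¹ := ⟨_, rfl⟩
  have hAtri : IsUnitri A := by rw [hAdef]; exact IsUnitri.inv' hUtri
  have hAU : A * U = 1 := by rw [hAdef]; exact Matrix.nonsing_inv_mul _ hUdet
  -- columns `0 … d-1` of `A * L` are the unit subdiagonal pattern
  have hcol : ∀ (j k : Fin (d + 1)) (hk : k.val + 1 < d + 1),
      (A * L) j k = if j.val = k.val + 1 then 1 else 0 := by
    intro j k hk
    have h := congrFun (congrFun hAU j) ⟨k.val + 1, hk⟩
    rw [Matrix.mul_apply, Matrix.one_apply] at h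
    have hrw : (∑ x : Fin (d + 1), A j x * U x ⟨k.val + 1, hk⟩) = ∑ x : Fin (d + 1), A j x * L x k :=
      Finset.sum_congr rfl fun x _ => by rw [hUsucc x k hk]
    rw [hrw] at h
    rw [Matrix.mul_apply, h]
    by_cases hjk : j.val = k.val + 1
    · rw [if_pos hjk, if_pos (Fin.ext hjk)]
    · rw [if_neg hjk, if_neg (fun h' => hjk (by rw [h']))]
  -- the last column of `A * L` and the column eliminator
  obtain ⟨c, hcdef⟩ : ∃ c : Fin (d + 1) → ZMod 2, c = fun j => (A * L) j (Fin.last d) := ⟨_, rfl⟩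
  obtain ⟨B, hBdef⟩ : ∃ B : Mat d, B = Matrix.of fun l k : Fin (d + 1) =>
      (if l = k then (1 : ZMod 2) else 0) +
        (if hk : k = Fin.last d ∧ l.val + 1 < d + 1 then c ⟨l.val + 1, hk.2⟩ else 0) := ⟨_, rfl⟩
  have hBapply : ∀ l k : Fin (d + 1), B l k = (if l = k then (1 : ZMod 2) else 0) +
      (if hk : k = Fin.last d ∧ l.val + 1 < d + 1 then c ⟨l.val + 1, hk.2⟩ else 0) := by
    intro l k; rw [hBdef, Matrix.of_apply]
  have hBlast : IsLastCol B := by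
    refine ⟨fun i => ?_, fun i j hij hj => ?_⟩
    · rw [hBapply, if_pos rfl, dif_neg, add_zero]
      rintro ⟨h1, h2⟩
      rw [h1] at h2; simp at h2
    · rw [hBapply, if_neg hij, zero_add, dif_neg (fun h => hj h.1)]
  refine ⟨A, B, hAtri, hBlast, ?_⟩
  -- the product is `canon (c 0)`
  have hprod : A * L * B = canon (c 0) := by
    ext j k
    rw [mul_lastCol_apply hBlast, canon_apply]
    by_cases hk : k = Fin.last d
    · subst hk
      rw [if_pos rfl]
      have hterm : ∀ l : Fin (d + 1), (A * L) j l * B l (Fin.last d) =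
          (if l = Fin.last d then c j else 0) +
            (if hl : l.val + 1 < d + 1 then (if j.val = l.val + 1 then c ⟨l.val + 1, hl⟩ else 0) else 0) := by
        intro l
        rw [hBapply]
        by_cases hl : l = Fin.last d
        · subst hl
          have hno : ¬ ((Fin.last d) = Fin.last d ∧ (Fin.last d).val + 1 < d + 1) := by simp
          have hno' : ¬ ((Fin.last d).val + 1 < d + 1) := by simp
          rw [if_pos rfl, dif_neg hno, if_pos rfl, dif_neg hno', add_zero, mul_one, add_zero]
          exact (congrFun hcdef j).symm
        · have hl' : l.val + 1 < d + 1 := by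
            have := Fin.val_lt_last hl; omega
          rw [if_neg hl, zero_add, dif_pos ⟨rfl, hl'⟩, if_neg hl, zero_add, dif_pos hl', hcol j l hl']
          by_cases hjl : j.val = l.val + 1
          · rw [if_pos hjl, if_pos hjl, one_mul]
          · rw [if_neg hjl, if_neg hjl, zero_mul]
      rw [Finset.sum_congr rfl fun l _ => hterm l, Finset.sum_add_distrib]
      have hs1 : (∑ l : Fin (d + 1), (if l = Fin.last d then c j else 0)) = c j := by
        rw [Finset.sum_ite_eq']; simp
      rw [hs1]
      have hjlast : ¬ (j.val = (Fin.last d).val + 1) := by have := j.isLt; simp; omega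
      rw [if_neg hjlast, zero_add]
      by_cases hj : j = 0
      · subst hj
        rw [if_pos ⟨rfl, rfl⟩]
        have hs2 : (∑ l : Fin (d + 1), (if hl : l.val + 1 < d + 1 then
            (if (0 : Fin (d + 1)).val = l.val + 1 then c ⟨l.val + 1, hl⟩ else 0) else 0)) = 0 := by
          refine Finset.sum_eq_zero fun l _ => ?_
          by_cases h1 : l.val + 1 < d + 1
          · rw [dif_pos h1, if_neg (by simp)]
          · rw [dif_neg h1]
        rw [hs2, add_zero]
      · rw [if_neg (show ¬ ((j = 0) ∧ Fin.last d = Fin.last d) from fun h => hj h.1)]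
        have hjpos : 0 < j.val := Nat.pos_of_ne_zero fun h => hj (Fin.ext h)
        have hs2 : (∑ l : Fin (d + 1), (if hl : l.val + 1 < d + 1 then
            (if j.val = l.val + 1 then c ⟨l.val + 1, hl⟩ else 0) else 0)) = c j := by
          rw [Finset.sum_eq_single ⟨j.val - 1, by omega⟩]
          · have hl : (⟨j.val - 1, by omega⟩ : Fin (d + 1)).val + 1 < d + 1 := by simp; omega
            rw [dif_pos hl, if_pos (by simp; omega)]
            congr 1
            exact Fin.ext (by simp; omega)
          · intro l _ hl
            by_cases h1 : l.val + 1 < d + 1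
            · rw [dif_pos h1, if_neg]
              intro h2; apply hl; exact Fin.ext (by simp; omega)
            · rw [dif_neg h1]
          · simp
        rw [hs2]
        -- `c j + c j = 0` over `F₂`
        have h2 : (2 : ZMod 2) = 0 := by decide
        rw [← two_mul, h2, zero_mul]
    · rw [if_neg hk]
      have hk' : k.val + 1 < d + 1 := by have := Fin.val_lt_last hk; omega
      rw [hcol j k hk', if_neg (show ¬ (j = 0 ∧ k = Fin.last d) from fun h => hk h.2), add_zero]
  -- identify the corner with the determinant
  have hdet : c 0 = L.det := by
    have h1 : (A * L * B).det = L.det := by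
      rw [Matrix.det_mul, Matrix.det_mul, IsUnitri.det_eq_one' hAtri, IsUnitri.det_eq_one' hBlast.isUnitri,
        one_mul, mul_one]
    rw [hprod, det_canon'] at h1
    exact h1
  rw [hprod, hdet]


theorem exists_eq_canon_conj' (L : Mat d)
    (hsub : ∀ i j : Fin (d + 1), i.val = j.val + 1 → L i j = 1)
    (hlow : ∀ i j : Fin (d + 1), j.val + 1 < i.val → L i j = 0) :
    ∃ A B : Mat d, IsUnitri A ∧ IsLastCol B ∧ L = A * canon L.det * B := by
  obtain ⟨A, B, hA, hB, h⟩ := exists_canon_of_hessenberg' L hsub hlow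
  have hAdet : IsUnit A.det := by rw [IsUnitri.det_eq_one' hA]; exact isUnit_one
  refine ⟨A⁻¹, B, IsUnitri.inv' hA, hB, ?_⟩
  rw [← h]
  simp only [Matrix.mul_assoc]
  rw [← Matrix.mul_assoc A⁻¹ A, Matrix.nonsing_inv_mul A hAdet, Matrix.one_mul, hB.mul_self, Matrix.mul_one]


/-! ## §1 Values of the block -/

variable {v w : ℕ → ZMod 2}

/-- The evaluated symbolic matrix `L(v)`. -/
def matL (d : ℕ) (Lsym : ℕ → ℕ → List (List ℕ)) (v : ℕ → ZMod 2) : Mat d :=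
  Matrix.of fun j l : Fin (d + 1) => evalP v (Lsym j.val l.val)

/-- **The entries of `blockOf` evaluate to the entries of `R₁ · L(v) · R₂`** (as `RandPoly.evalP_entry`). -/
theorem evalP_entryOf (n₀ : ℕ) (Lsym : ℕ → ℕ → List (List ℕ)) (i k : Fin (d + 1)) :
    evalP v (entryOf n₀ d Lsym i.val k.val) =
      (matR1 n₀ d v * matL d Lsym v * matR2 n₀ d v) i k := by
  rw [entryOf, evalP_flatMap, sum_map_range, Finset.sum_range, Matrix.mul_apply]
  simp_rw [evalP_flatMap, sum_map_range, Finset.sum_range, evalP_mulP, Matrix.mul_apply,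
    Finset.sum_mul]
  rw [Finset.sum_comm]
  refine Finset.sum_congr rfl fun l _ => Finset.sum_congr rfl fun j _ => ?_
  rw [evalP_symR1, evalP_symR2]
  rfl

/-- Equality of the values of two blocks is equality of the projections (as `RandPoly.evalM_ikBlock_eq_iff`). -/
theorem evalM_blockOf_eq_iff (n₀ : ℕ) (Lsym : ℕ → ℕ → List (List ℕ)) (v w : ℕ → ZMod 2) :
    evalM v (blockOf n₀ d Lsym) = evalM w (blockOf n₀ d Lsym) ↔
      ∀ i k : Fin (d + 1), i ≤ k →
        (matR1 n₀ d v * matL d Lsym v * matR2 n₀ d v) i k =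
          (matR1 n₀ d w * matL d Lsym w * matR2 n₀ d w) i k := by
  simp only [blockOf, evalM, List.map_map]
  rw [List.map_inj_left]
  constructor
  · intro h i k hik
    have := h (i.val, k.val) (mem_pairsLE.2 ⟨hik, Nat.le_of_lt_succ k.isLt⟩)
    simpa only [Function.comp_apply, evalP_entryOf] using this
  · rintro h ⟨i, k⟩ hik
    obtain ⟨hik, hkd⟩ := mem_pairsLE.1 hik
    have hi : i < d + 1 := by simp only at hik hkd; omega
    have hk : k < d + 1 := by simp only at hkd; omega
    have h1 := h ⟨i, hi⟩ ⟨k, hk⟩ hik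
    rw [← evalP_entryOf, ← evalP_entryOf] at h1
    exact h1

section Hess

variable {n₀ : ℕ} {Lsym : ℕ → ℕ → List (List ℕ)}
  (hsub : ∀ j l : ℕ, j = l + 1 → Lsym j l = [[]])
  (hlow : ∀ j l : ℕ, l + 1 < j → Lsym j l = [])
  (hvars : ∀ j l : ℕ, j ≤ l → ∀ μ ∈ Lsym j l, ∀ x ∈ μ, x < n₀)

include hsub in
/-- `L(v)` has unit subdiagonal. -/
theorem matL_sub (v : ℕ → ZMod 2) (i j : Fin (d + 1)) (h : i.val = j.val + 1) : matL d Lsym v i j = 1 := by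
  simp [matL, hsub i.val j.val h, evalP]

include hlow in
/-- `L(v)` is zero below the subdiagonal. -/
theorem matL_low (v : ℕ → ZMod 2) (i j : Fin (d + 1)) (h : j.val + 1 < i.val) : matL d Lsym v i j = 0 := by
  simp [matL, hlow i.val j.val h, evalP]

include hsub hlow hvars in
/-- `L(v)` depends only on the variables below `n₀`. -/
theorem matL_congr (h : AgreeBelow n₀ v w) : matL d Lsym v = matL d Lsym w := by
  ext j l
  simp only [matL, Matrix.of_apply]
  refine evalP_congr fun μ hμ x hx => h x ?_
  by_cases hjl : j.val ≤ l.val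
  · exact hvars _ _ hjl μ hμ x hx
  · by_cases hjl' : j.val = l.val + 1
    · rw [hsub _ _ hjl'] at hμ
      simp only [List.mem_singleton] at hμ
      subst hμ; simp at hx
    · rw [hlow _ _ (by omega)] at hμ
      simp at hμ

end Hess

/-! ## §2 The three matrix facts for unit-lower-Hessenberg matrices -/

/-- **Injectivity** of `(A, B) ↦ proj (A · L · B)` for a Hessenberg `L` (as `RandPoly.eq_of_proj_pathMat_eq`). -/
theorem eq_of_proj_hess_eq {L : Mat d}
    (hs : ∀ i j : Fin (d + 1), i.val = j.val + 1 → L i j = 1)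
    (hl : ∀ i j : Fin (d + 1), j.val + 1 < i.val → L i j = 0)
    {A A' B B' : Mat d} (hA : IsUnitri A) (hA' : IsUnitri A') (hB : IsLastCol B) (hB' : IsLastCol B')
    (h : ∀ i k : Fin (d + 1), i ≤ k → (A * L * B) i k = (A' * L * B') i k) :
    A = A' ∧ B = B' := by
  obtain ⟨A₁, B₁, hA₁, hB₁, hL⟩ := exists_eq_canon_conj' L hs hl
  have key : ∀ M N : Mat d, M * L * N = (M * A₁) * canon L.det * (B₁ * N) := fun M N => by
    conv_lhs => rw [hL]
    simp only [Matrix.mul_assoc]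
  simp only [key] at h
  obtain ⟨h1, h2, -⟩ := eq_of_proj_canon_eq (hA.mul hA₁) (hA'.mul hA₁) (hB₁.mul hB) (hB₁.mul hB') h
  exact ⟨hA₁.isUnit.mul_right_cancel h1, hB₁.isUnitri.isUnit.mul_left_cancel h2⟩

/-- **Decodability**: the projection of `A · L · B` determines `det L` (as `RandPoly.pathVal_eq_of_proj_eq`). -/
theorem det_eq_of_proj_eq {L L' : Mat d}
    (hs : ∀ i j : Fin (d + 1), i.val = j.val + 1 → L i j = 1)
    (hl : ∀ i j : Fin (d + 1), j.val + 1 < i.val → L i j = 0)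
    (hs' : ∀ i j : Fin (d + 1), i.val = j.val + 1 → L' i j = 1)
    (hl' : ∀ i j : Fin (d + 1), j.val + 1 < i.val → L' i j = 0)
    {A A' B B' : Mat d} (hA : IsUnitri A) (hA' : IsUnitri A') (hB : IsLastCol B) (hB' : IsLastCol B')
    (h : ∀ i k : Fin (d + 1), i ≤ k → (A * L * B) i k = (A' * L' * B') i k) :
    L.det = L'.det := by
  obtain ⟨A₁, B₁, hA₁, hB₁, hL⟩ := exists_eq_canon_conj' L hs hl
  obtain ⟨A₂, B₂, hA₂, hB₂, hL'⟩ := exists_eq_canon_conj' L' hs' hl'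
  have key1 : ∀ M N : Mat d, M * L * N = (M * A₁) * canon L.det * (B₁ * N) := fun M N => by
    conv_lhs => rw [hL]
    simp only [Matrix.mul_assoc]
  have key2 : ∀ M N : Mat d, M * L' * N = (M * A₂) * canon L'.det * (B₂ * N) := fun M N => by
    conv_lhs => rw [hL']
    simp only [Matrix.mul_assoc]
  have h' : ∀ i k : Fin (d + 1), i ≤ k →
      ((A * A₁) * canon L.det * (B₁ * B) : Mat d) i k = ((A' * A₂) * canon L'.det * (B₂ * B') : Mat d) i k := by
    intro i k hik; rw [← key1, ← key2]; exact h i k hik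
  exact (eq_of_proj_canon_eq (hA.mul hA₁) (hA'.mul hA₂) (hB₁.mul hB) (hB₂.mul hB') h').2.2

/-- **Range**: Hessenberg matrices with the same determinant have the same randomizations
(as `RandPoly.exists_proj_pathMat_eq`). -/
theorem exists_proj_hess_eq {L L' : Mat d}
    (hs : ∀ i j : Fin (d + 1), i.val = j.val + 1 → L i j = 1)
    (hl : ∀ i j : Fin (d + 1), j.val + 1 < i.val → L i j = 0)
    (hs' : ∀ i j : Fin (d + 1), i.val = j.val + 1 → L' i j = 1)
    (hl' : ∀ i j : Fin (d + 1), j.val + 1 < i.val → L' i j = 0)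
    (hdet : L.det = L'.det) {A B : Mat d} (hA : IsUnitri A) (hB : IsLastCol B) :
    ∃ A' B' : Mat d, IsUnitri A' ∧ IsLastCol B' ∧ A' * L' * B' = A * L * B := by
  obtain ⟨A₁, B₁, hA₁, hB₁, hL⟩ := exists_eq_canon_conj' L hs hl
  obtain ⟨A₂, B₂, hA₂, hB₂, hL'⟩ := exists_eq_canon_conj' L' hs' hl'
  have hA₂det : IsUnit A₂.det := by rw [IsUnitri.det_eq_one' hA₂]; exact isUnit_one
  refine ⟨A * A₁ * A₂⁻¹, B₂ * B₁ * B, (hA.mul hA₁).mul (IsUnitri.inv' hA₂), (hB₂.mul hB₁).mul hB, ?_⟩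
  rw [← hdet] at hL'
  conv_lhs => rw [hL']
  conv_rhs => rw [hL]
  simp only [Matrix.mul_assoc]
  rw [← Matrix.mul_assoc A₂⁻¹ A₂, Matrix.nonsing_inv_mul A₂ hA₂det, Matrix.one_mul,
    ← Matrix.mul_assoc B₂ B₂, hB₂.mul_self, Matrix.one_mul]

/-! ## §3 The block is a perfect extension of the determinant (`stub_blockPerf`, unconditionally) -/

/-- **The degree-3 block of a symbolic unit-lower-Hessenberg matrix is a perfect extension of its determinant**
(the statement of `stub_blockPerf`, with the canonical form PROVED rather than assumed). -/
theorem perfExt_blockOf :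
    ∀ (n₀ d : ℕ) (Lsym : ℕ → ℕ → List (List ℕ)),
      (∀ j l : ℕ, j = l + 1 → Lsym j l = [[]]) →
      (∀ j l : ℕ, l + 1 < j → Lsym j l = []) →
      (∀ j l : ℕ, j ≤ l → ∀ μ ∈ Lsym j l, ∀ x ∈ μ, x < n₀) →
      RandPoly.PerfExt n₀ (n₀ + RandPoly.pos d d) (blockOf n₀ d Lsym)
        (fun v => (Matrix.of fun (j l : Fin (d + 1)) => RandPoly.evalP v (Lsym j.val l.val)).det) := by
  intro n₀ d Lsym hsub hlow hvars
  change PerfExt n₀ (n₀ + pos d d) (blockOf n₀ d Lsym) (fun v => (matL d Lsym v).det)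
  have hs : ∀ v : ℕ → ZMod 2, ∀ i j : Fin (d + 1), i.val = j.val + 1 → matL d Lsym v i j = 1 :=
    fun v => matL_sub hsub v
  have hl : ∀ v : ℕ → ZMod 2, ∀ i j : Fin (d + 1), j.val + 1 < i.val → matL d Lsym v i j = 0 :=
    fun v => matL_low hlow v
  refine ⟨fun v w hvw he => ?_, fun v w he => ?_, fun v w hf => ?_⟩
  · -- injectivity on the fresh block
    rw [evalM_blockOf_eq_iff, matL_congr hsub hlow hvars hvw] at he
    obtain ⟨hA, hB⟩ := eq_of_proj_hess_eq (hs w) (hl w) (matR1_isUnitri n₀ d v) (matR1_isUnitri n₀ d w)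
      (matR2_isLastCol n₀ d v) (matR2_isLastCol n₀ d w) he
    intro m hm
    by_cases hmn : m < n₀
    · exact hvw m hmn
    obtain ⟨i, k, hik, hkd, hor, hpos⟩ := exists_pos_eq (m := m - n₀) (d := d) (by omega)
    have hm' : m = n₀ + pos i k := by omega
    rw [hm']
    have hk1 : k < d + 1 := by omega
    by_cases hlt : i < k
    · have h1 := congrFun (congrFun hA ⟨i, by omega⟩) ⟨k, hk1⟩
      rwa [matR1_apply_of_lt n₀ v (Fin.mk_lt_mk.2 hlt), matR1_apply_of_lt n₀ w (Fin.mk_lt_mk.2 hlt)]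
        at h1
    · have hik' : i = k := by omega
      subst hik'
      have hkd' : i < d := by omega
      have hne : (⟨i, hk1⟩ : Fin (d + 1)) ≠ Fin.last d := fun h' => by
        have := congrArg Fin.val h'; simp at this; omega
      have h1 := congrFun (congrFun hB ⟨i, hk1⟩) (Fin.last d)
      rwa [matR2_apply_last n₀ v hne, matR2_apply_last n₀ w hne] at h1
  · -- decodability
    rw [evalM_blockOf_eq_iff] at he
    exact det_eq_of_proj_eq (hs v) (hl v) (hs w) (hl w) (matR1_isUnitri n₀ d v) (matR1_isUnitri n₀ d w)
      (matR2_isLastCol n₀ d v) (matR2_isLastCol n₀ d w) he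
  · -- range
    change (matL d Lsym v).det = (matL d Lsym w).det at hf
    obtain ⟨A', B', hA', hB', heq⟩ :=
      exists_proj_hess_eq (hs v) (hl v) (hs w) (hl w) hf (matR1_isUnitri n₀ d v) (matR2_isLastCol n₀ d v)
    -- the valuation realising `(A', B')` over the prefix of `w` (verbatim `perfExt_ikBlock`)
    let u : ℕ → ZMod 2 := fun m =>
      if m < n₀ then w m else
        match (pairsLE d).find? (fun ab => n₀ + pos ab.1 ab.2 = m) with
        | some ab =>
          if h : ab.1 < ab.2 ∧ ab.2 < d + 1 then A' ⟨ab.1, by omega⟩ ⟨ab.2, h.2⟩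
          else if h : ab.1 = ab.2 ∧ ab.2 < d then B' ⟨ab.1, by omega⟩ (Fin.last d)
          else w m
        | none => w m
    have huw : AgreeBelow n₀ u w := fun m hm => by simp [u, hm]
    have hAu : matR1 n₀ d u = A' := by
      ext i j
      rcases lt_trichotomy i j with hij | rfl | hji
      · rw [matR1_apply_of_lt n₀ u hij]
        have hfind := find?_pairsLE_pos (d := d) n₀ (le_of_lt (Fin.lt_def.1 hij))
          (Nat.le_of_lt_succ j.isLt)
        simp only [u, if_neg (by omega : ¬ (n₀ + pos i.val j.val < n₀)), hfind]
        rw [dif_pos ⟨Fin.lt_def.1 hij, j.isLt⟩]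
      · rw [(matR1_isUnitri n₀ d u).1, hA'.1]
      · rw [(matR1_isUnitri n₀ d u).2 i j hji, hA'.2 i j hji]
    have hBu : matR2 n₀ d u = B' := by
      ext l k
      by_cases hk : k = Fin.last d
      · subst hk
        by_cases hl' : l = Fin.last d
        · rw [hl', (matR2_isLastCol n₀ d u).1, hB'.1]
        · rw [matR2_apply_last n₀ u hl']
          have hld : l.val < d := Fin.val_lt_last hl'
          have hfind := find?_pairsLE_pos (d := d) n₀ (le_refl l.val) (le_of_lt hld)
          simp only [u, if_neg (by omega : ¬ (n₀ + pos l.val l.val < n₀)), hfind]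
          split_ifs with h1 h2
          · exact absurd h1.1 (lt_irrefl _)
          · rfl
          · exact absurd ⟨trivial, hld⟩ h2
      · by_cases hlk : l = k
        · subst hlk; rw [(matR2_isLastCol n₀ d u).1, hB'.1]
        · rw [(matR2_isLastCol n₀ d u).2 l k hlk hk, hB'.2 l k hlk hk]
    refine ⟨u, huw, ?_⟩
    rw [evalM_blockOf_eq_iff, hAu, hBu, matL_congr hsub hlow hvars huw, heq]
    exact fun _ _ _ => rfl

end Summit.PneNP.PneNP.Cruxes.PeaWorstToAvg.Drefute
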